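import Summits.ResolutionOfSingularities.ResolutionOfSingularities.Theorems.AbsoluteGiraudBranch
import Literature.AlgebraicGeometry.Resolution.SymbolicPowersRsop
import Literature.AlgebraicGeometry.Resolution.RegularRestrictionLocalPow
import Literature.AlgebraicGeometry.Resolution.QuasiRegularSequences
import Literature.AlgebraicGeometry.Resolution.BlowupDimension
import Literature.AlgebraicGeometry.Resolution.BlowupStalkCharts
import Literature.AlgebraicGeometry.Resolution.BlowupChartRsop
import Literature.AlgebraicGeometry.Resolution.OrderSemicontinuityPointwise
import Literature.AlgebraicGeometry.Resolution.StrictNormalCrossingsFlatDescent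
import Literature.AlgebraicGeometry.Resolution.StrictNormalCrossingsHasSNC
import Literature.AlgebraicGeometry.Resolution.SncStrata
import Literature.AlgebraicGeometry.Resolution.PrimeDivisorIdeals
import Literature.AlgebraicGeometry.Resolution.StalkIdealGenerization
import Literature.AlgebraicGeometry.Resolution.RegularLocalRingsProofs
import Literature.AlgebraicGeometry.Resolution.NormalCrossingsBlowupStepReduction
import HarnessLib

/-!
# RegularCurveDepth — decomp-res node «RegularCurveLaw / CurveCut» (lens-6 g17 rev 1), tree file 1/6: §9 (NEW
· KERNEL) the 𝔭-adic DEPTH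
FILTRATION of a local ring and the one-round depth law — pure commutative algebra, absolute part (`depthIdeal` and
its calculus).  PROVED,
universe-generic.  Relative part (w.r.t. a transversal parameter): `RegularCurveDepthRel`.

Content VERBATIM from the decomp-res lens-6 g17 file
`HOME/decomp-res-lens-6/g17/parts/RegularCurveLaw-REV1-5548be76.lean` (sha256 5548be7624d15d37;
CRITIC-LEDGER row 128; critic landing order 2026-08-30T18:16:59Z).  Its §0–§8 are g16 `AbsoluteGiraud.lean`
@bc25b587 byte-identical and ALREADY in
the tree as `Theorems/AbsoluteContact{Scope,Primitives,HasseRing,Hasse,Axes}` + `AbsoluteGiraud{Kernel,Branch}`;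
only §9–§13 are landed here.
HOME = run/shared/lean/pub/decomp-res.  Host: route `MaxContactCut`, asides AGHypHug3Insep 27753 / AGAbsContactOff3
27752 / AGAllHug3Off3 27751
(refining 31574 `PVPureGame`).

[WRITER NOTE (decomp-res writer g6): the critic asked for Literature/…/Resolution placement of the scheme-level
kernels §9/§10; they land
Summits-side because the Literature gate accepts only [cite:]-tagged PUBLISHED statements (same ruling as `CouplingCutCoupled` /
`AbsoluteGiraudKernel`).  ONE namespace `…Theorems.AbsoluteContactClasses` as in the lens; global `set_option`
lines dropped (scoped
`set_option maxHeartbeats … in` kept); nothing else changed.]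
(Sources: Giraud1975; EncinasVillamayor2000 Thm. 4.9; BravoGarciaEscamillaVillamayor2012 Lemma 4.6;
VillamayorU2008ReesDiff §4; CossartPiltant2008 §2; CossartJannsenSaito2020 §2–§3; EGAIV4 §16–§17;
Matsumura1986 §14–§17.)
-/

noncomputable section

open CategoryTheory AlgebraicGeometry TopologicalSpace
open Literature.AlgebraicGeometry.Resolution
open Summit.ResolutionOfSingularities.ResolutionOfSingularities.Theorems
open WeakOrderReduction ForcedTowerClasses PurityValveClasses
open SatelliteExitClasses
open IsLocalRing MvPolynomial

namespace Summit.ResolutionOfSingularities.ResolutionOfSingularities.Theorems.AbsoluteContactClasses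

universe uD
section DepthAlgebra

variable {R : Type uD} [CommRing R]

/-- **Sharp binomial estimate** `(I ⊔ J) ^ n ≤ I ^ a ⊔ J ^ b` whenever `a + b ≤ n + 1`.
[folklore] -/
theorem sup_pow_le_pow_sup_pow (I J : Ideal R) :
    ∀ n a b : ℕ, a + b ≤ n + 1 → (I ⊔ J) ^ n ≤ I ^ a ⊔ J ^ b := by
  intro n
  induction n with
  | zero =>
    intro a b hab
    rcases Nat.eq_zero_or_pos a with ha | ha
    · rw [ha, pow_zero I, Ideal.one_eq_top, top_sup_eq]; exact le_top
    · have hb : b = 0 := by omega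
      rw [hb, pow_zero J, Ideal.one_eq_top, sup_top_eq]; exact le_top
  | succ n ih =>
    intro a b hab
    rcases Nat.eq_zero_or_pos a with ha | ha
    · rw [ha, pow_zero I, Ideal.one_eq_top, top_sup_eq]; exact le_top
    rcases Nat.eq_zero_or_pos b with hb | hb
    · rw [hb, pow_zero J, Ideal.one_eq_top, sup_top_eq]; exact le_top
    obtain ⟨a', rfl⟩ := Nat.exists_eq_succ_of_ne_zero ha.ne'
    obtain ⟨b', rfl⟩ := Nat.exists_eq_succ_of_ne_zero hb.ne'
    have h1 : (I ⊔ J) ^ n ≤ I ^ a' ⊔ J ^ (b' + 1) := ih a' (b' + 1) (by omega)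
    have h2 : (I ⊔ J) ^ n ≤ I ^ (a' + 1) ⊔ J ^ b' := ih (a' + 1) b' (by omega)
    rw [pow_succ', Ideal.sup_mul]
    refine sup_le ?_ ?_
    · calc I * (I ⊔ J) ^ n ≤ I * (I ^ a' ⊔ J ^ (b' + 1)) := Ideal.mul_mono_right h1
        _ = I * I ^ a' ⊔ I * J ^ (b' + 1) := Ideal.mul_sup _ _ _
        _ ≤ I ^ (a' + 1) ⊔ J ^ (b' + 1) :=
          sup_le_sup (by rw [← pow_succ']) Ideal.mul_le_left
    · calc J * (I ⊔ J) ^ n ≤ J * (I ^ (a' + 1) ⊔ J ^ b') := Ideal.mul_mono_right h2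
        _ = J * I ^ (a' + 1) ⊔ J * J ^ b' := Ideal.mul_sup _ _ _
        _ ≤ I ^ (a' + 1) ⊔ J ^ (b' + 1) :=
          sup_le_sup Ideal.mul_le_left (by rw [← pow_succ'])

/-- A form of degree `d` satisfies `G(t • x) = t ^ d * G(x)`. [folklore] -/
theorem eval_smul_eq_pow_mul {S : Type*} [CommSemiring S] {ι : Type*} {G : MvPolynomial ι S}
    {d : ℕ} (hG : G.IsHomogeneous d) (t : S) (x : ι → S) :
    MvPolynomial.eval (t • x) G = t ^ d * MvPolynomial.eval x G := by
  classical
  conv_lhs => rw [← G.support_sum_monomial_coeff]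
  conv_rhs => rw [← G.support_sum_monomial_coeff]
  rw [map_sum, map_sum, Finset.mul_sum]
  refine Finset.sum_congr rfl fun m hm => ?_
  have hdeg : (m.sum fun _ e => e) = d := by
    have := hG (mem_support_iff.1 hm)
    simpa only [Finsupp.weight_apply, Pi.one_apply, smul_eq_mul, mul_one] using this
  rw [eval_monomial, eval_monomial, Finsupp.prod, Finsupp.prod]
  simp only [Pi.smul_apply, smul_eq_mul, mul_pow, Finset.prod_mul_distrib,
    Finset.prod_pow_eq_pow_sum]
  rw [show (∑ i ∈ m.support, m i) = d from hdeg]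
  ring

/-- `σ (G(w)) = (σG)(σ ∘ w)`. [folklore] -/
theorem ringHom_eval {S : Type*} [CommRing S] {ι : Type*} (σ : R →+* S) (w : ι → R)
    (G : MvPolynomial ι R) :
    σ (MvPolynomial.eval w G) = MvPolynomial.eval (σ ∘ w) (MvPolynomial.map σ G) := by
  rw [MvPolynomial.eval_map]
  show σ (MvPolynomial.eval₂ (RingHom.id R) w G) = _
  rw [MvPolynomial.eval₂_comp_left, RingHom.comp_id]

variable [IsLocalRing R]

/-- The **depth filtration** of `P ^ c` relative to `𝔪`:
`Q_{c,ν} = 𝔪 ^ ν · P ^ c + P ^ (c+1)`. For `P` the ideal of a regular curve germ with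
`𝔪 = (s) + P` one has `Q_{c,ν} = s ^ ν P ^ c + P ^ (c+1)`: the elements of `P ^ c` whose degree-`c`
form in the transversal parameters has all its coefficients of `s`-adic order `≥ ν`. -/
def depthIdeal (P : Ideal R) (c ν : ℕ) : Ideal R :=
  maximalIdeal R ^ ν * P ^ c ⊔ P ^ (c + 1)

/-- `depthIdeal_le_pow`: Auxiliary step of this node's calculus, VERBATIM from the lens file (see the module docstring); the statement is its type. [folklore] -/
theorem depthIdeal_le_pow (P : Ideal R) (c ν : ℕ) : depthIdeal P c ν ≤ P ^ c :=
  sup_le Ideal.mul_le_left (Ideal.pow_le_pow_right (Nat.le_succ c))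

/-- `pow_succ_le_depthIdeal`: Auxiliary step of this node's calculus, VERBATIM from the lens file (see the module docstring); the statement is its type. [folklore] -/
theorem pow_succ_le_depthIdeal (P : Ideal R) (c ν : ℕ) : P ^ (c + 1) ≤ depthIdeal P c ν :=
  le_sup_right

/-- `depthIdeal_antitone`: Auxiliary step of this node's calculus, VERBATIM from the lens file (see the module docstring); the statement is its type. [folklore] -/
theorem depthIdeal_antitone (P : Ideal R) (c : ℕ) {ν ν' : ℕ} (h : ν ≤ ν') :
    depthIdeal P c ν' ≤ depthIdeal P c ν :=
  sup_le_sup_right (Ideal.mul_mono_left (Ideal.pow_le_pow_right h)) _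

/-- `depthIdeal_zero`: Auxiliary step of this node's calculus, VERBATIM from the lens file (see the module docstring); the statement is its type. [folklore] -/
theorem depthIdeal_zero (P : Ideal R) (c : ℕ) : depthIdeal P c 0 = P ^ c := by
  rw [depthIdeal, pow_zero, one_mul]
  exact sup_eq_left.mpr (Ideal.pow_le_pow_right (Nat.le_succ c))

/-- `depthIdeal_le_sup`: Auxiliary step of this node's calculus, VERBATIM from the lens file (see the module docstring); the statement is its type. [folklore] -/
theorem depthIdeal_le_sup (P : Ideal R) (c ν : ℕ) :
    depthIdeal P c ν ≤ maximalIdeal R ^ ν ⊔ P ^ (c + 1) :=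
  sup_le_sup_right Ideal.mul_le_right _

/-- Transport of the depth filtration along a ring isomorphism of local rings. [folklore] -/
theorem depthIdeal_map_ringEquiv {S : Type*} [CommRing S] [IsLocalRing S] (e : R ≃+* S)
    (P : Ideal R) (c ν : ℕ) :
    (depthIdeal P c ν).map e = depthIdeal (P.map e) c ν := by
  rw [depthIdeal, depthIdeal, Ideal.map_sup, Ideal.map_mul, Ideal.map_pow, Ideal.map_pow,
    Ideal.map_pow, map_ringEquiv_maximalIdeal]

/-- `mem_depthIdeal_iff_of_ringEquiv`: Auxiliary step of this node's calculus, VERBATIM from the lens file (see the module docstring); the statement is its type. [folklore] -/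
theorem mem_depthIdeal_iff_of_ringEquiv {S : Type*} [CommRing S] [IsLocalRing S] (e : R ≃+* S)
    (P : Ideal R) (c ν : ℕ) (f : R) :
    f ∈ depthIdeal P c ν ↔ e f ∈ depthIdeal (P.map e) c ν := by
  rw [← depthIdeal_map_ringEquiv]
  constructor
  · intro h; exact Ideal.mem_map_of_mem _ h
  · intro h
    obtain ⟨x, hx, hxe⟩ := (Ideal.mem_map_of_equiv e (e f)).mp h
    rwa [← e.injective hxe]

/-- **Krull**: an element of every depth lies in `P ^ (c+1)`. [folklore] -/
theorem mem_pow_succ_of_forall_mem_depthIdeal [IsNoetherianRing R] (P : Ideal R) (c : ℕ) {f : R}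
    (h : ∀ ν, f ∈ depthIdeal P c ν) : f ∈ P ^ (c + 1) := by
  set J : Ideal R := P ^ (c + 1)
  have hk : ∀ ν, Ideal.Quotient.mk J f ∈ (maximalIdeal R ^ ν • ⊤ : Submodule R (R ⧸ J)) := by
    intro ν
    obtain ⟨a, ha, b, hb, hab⟩ := Submodule.mem_sup.mp (depthIdeal_le_sup P c ν (h ν))
    have : Ideal.Quotient.mk J f = a • Ideal.Quotient.mk J 1 := by
      rw [← hab, map_add, (Ideal.Quotient.eq_zero_iff_mem).mpr hb, add_zero, Algebra.smul_def,
        Ideal.Quotient.algebraMap_eq, map_one, mul_one]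
    rw [this]
    exact Submodule.smul_mem_smul ha Submodule.mem_top
  have hbot := Ideal.iInf_pow_smul_eq_bot_of_isLocalRing (I := maximalIdeal R) (M := R ⧸ J)
    (maximalIdeal.isMaximal R).ne_top
  have hf : Ideal.Quotient.mk J f ∈ (⨅ i : ℕ, maximalIdeal R ^ i • ⊤ : Submodule R (R ⧸ J)) :=
    (Submodule.mem_iInf _).mpr hk
  rw [hbot, Submodule.mem_bot] at hf
  exact Ideal.Quotient.eq_zero_iff_mem.mp hf

end DepthAlgebra

end Summit.ResolutionOfSingularities.ResolutionOfSingularities.Theorems.AbsoluteContactClasses
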